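import Summits.Ventures.PackingBounds.ThreePointCert.C6Td11Cert

/-!
# A(6, arccos 1/3) ≤ 34 (three-point bound, degree 11, kernel-checked): kernel validation of Gram block R0 (chunks 49–52 of 88)

Framing: lottery ticket; floor = certified bounds/negative ranges. Venture `PackingBounds` (cell
`pub-packcert`), three-point SDP family. Integer data of a feasible point of the Bachoc–Vallentin
semidefinite program (n = 6, s = 1/3, degree d = 11, symmetric
sums of squares), derived by `pub-packcert-sdp/code/cert2lean.py` from the exact rational
certificate `sdp-n6-d11-s1-3-sym-lppolish-v1.json` of the cell (two independent exact verifiers + referee), in the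
units of the kernel checker `ThreePointCert.Check` (soundness `ThreePointCert.Sound`). Generated
file: plain lists of integers / monomials.
-/

namespace Summit.Ventures.PackingBounds.ThreePointCert.C6Td11

open Literature.Geometry.DiscreteGeometry Literature.Geometry.DiscreteGeometry.PolyCert PolyCert.SPoly

set_option maxHeartbeats 0 in
/-- Block `R0`: rows from 244 (3 rows) of `zᵀ(LLᵀ)z` added to `dR0c48` give `dR0c49` (kernel). -/
theorem okR0_49 : chunkOK C6Td11.gR0 244 3 C6Td11.dR0c48 C6Td11.dR0c49 = true := by
  decide +kernel

set_option maxHeartbeats 0 in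
/-- Block `R0`: rows from 247 (3 rows) of `zᵀ(LLᵀ)z` added to `dR0c49` give `dR0c50` (kernel). -/
theorem okR0_50 : chunkOK C6Td11.gR0 247 3 C6Td11.dR0c49 C6Td11.dR0c50 = true := by
  decide +kernel

set_option maxHeartbeats 0 in
/-- Block `R0`: rows from 250 (3 rows) of `zᵀ(LLᵀ)z` added to `dR0c50` give `dR0c51` (kernel). -/
theorem okR0_51 : chunkOK C6Td11.gR0 250 3 C6Td11.dR0c50 C6Td11.dR0c51 = true := by
  decide +kernel

set_option maxHeartbeats 0 in
/-- Block `R0`: rows from 253 (3 rows) of `zᵀ(LLᵀ)z` added to `dR0c51` give `dR0c52` (kernel). -/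
theorem okR0_52 : chunkOK C6Td11.gR0 253 3 C6Td11.dR0c51 C6Td11.dR0c52 = true := by
  decide +kernel

end Summit.Ventures.PackingBounds.ThreePointCert.C6Td11
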